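import Summits.CriticalPhenomena.PercolationContinuityZ3.Theorems.PercNearOneGluingNoHeavyLowerTailOneCutFourBlobs
import Summits.CriticalPhenomena.PercolationContinuityZ3.Theorems.PercNearOneGluingNoHeavyLowerTailBlockLonelyRelay
import HarnessLib

/-!
# `NoHeavyLowerTail` (stmt-CriticalPhenomena-4575) — the cumulative isolation lemma on blob structures, I:
# bookkeeping, the glued observer, and ALL-PAIRS-HEAVY blob structures (any number of blobs)

Support file (depth prover nh-dp-blobmono, blob-quotient line; `--supports stmt-CriticalPhenomena-4575`).
No definitions, no named facts, no sorries.

The lead's typed engine is the CUMULATIVE ISOLATION LEMMA (registered stub `stub_cumulativeIsolation`,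
reduction `Theorems.noHeavyLowerTail_of_stub_cumulativeIsolation`): for `μ = prodBernoulli w` on `Fin n`,
relays `A`, observer `o`, `N = |{x ∈ A : o ↔ x}|`, `π(a) = {x ∈ A : a ↔ x}` and a level `j`,
`CIL_j : ∃ a ∈ A, μ{1 ≤ N ≤ j} ≤ μ{|π(a)| ≤ j}` (landed for `|A| ≤ 4`: `…CILSmall`, `…CILFour`).
A BLOB STRUCTURE (`…OneCutThreeBlobs`) is a labelling `cls : Fin n → Fin b` with same-label points of
`insert o A` joined a.s.; with masses `m_ℓ = |A ∩ cls⁻¹ ℓ|`, `N` is the total mass of the blobs joined to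
`o`, so CIL on a blob structure is CIL for INTEGER-WEIGHTED relays — the light family `{S : m(S) ≤ j}` is a
general threshold family and `|A|` is arbitrary.  This file proves:

* `CILBlobs.cil_of_glued` — observer a.s. joined to a relay `x`: `μ{1 ≤ N ≤ j} ≤ μ{|π(x)| ≤ j}` (the
  equality case of CIL);
* `cumulativeIsolation_blobs_noLightPair` — ANY number of blobs: if no two distinct nonempty relay blobs
  are jointly light (`m_ℓ + m_ℓ' > j`), CIL_j holds.  On the good set the minority event is "o holds
  exactly one light blob `B_ℓ`, isolated from `A ∖ B_ℓ`"; Kozma–Nitzan's Lemma 2 with the light blobs as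
  pairwise disjoint blocks (`Theorems.blockLonelyRelay`) bounds the total by `max_ℓ μ{B_ℓ ↮ A ∖ B_ℓ}`,
  and `{B_ℓ ↮ A ∖ B_ℓ} ⊆ {|π(a_ℓ)| ≤ j}`.

Part II (`…CILFourBlobs`) finishes every blob structure with at most four blobs.  Numerics (exact partition
DP on weighted `K_n`, `n ≤ 8`, all threshold families on ≤ 4 relay blobs): `sup μ{1≤N≤j}/max_a μ{|π(a)|≤j}
= 1`, attained with `o` glued to a relay, never exceeded.
-/

noncomputable section

namespace Summit.CriticalPhenomena.PercolationContinuityZ3.Theorems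

open MeasureTheory Set Literature.Probability.LatticeModels Literature.Probability.Percolation
open scoped Classical BigOperators

variable {n : ℕ}

namespace CILBlobs

/-- If `o ↔ a` then `π(a) = π(o)` as relay sets, so `|π(a)| = N`. [folklore] -/
theorem piCard_eq_of_reachable (A : Finset (Fin n)) (o a : Fin n) (ω : BondConfig (Fin n))
    (hoa : (openGraph ω).Reachable o a) :
    (A.filter fun x => ω ∈ openConn a x).card = (A.filter fun x => ω ∈ openConn o x).card := by
  congr 1
  refine Finset.filter_congr fun x _ => ⟨fun h => ?_, fun h => ?_⟩
  · exact hoa.trans h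
  · exact hoa.symm.trans h

/-- On the good set, if `a ↮ y` then `π(a)` avoids the whole blob of `y`. [folklore] -/
theorem pi_avoids_label {b : ℕ} (A : Finset (Fin n)) (o : Fin n) (cls : Fin n → Fin b)
    (ω : BondConfig (Fin n))
    (hω : ∀ u ∈ insert o A, ∀ v ∈ insert o A, cls u = cls v → (openGraph ω).Reachable u v)
    {a y : Fin n} (hy : y ∈ A) (hay : ¬ (openGraph ω).Reachable a y) :
    ∀ x ∈ A.filter (fun x => ω ∈ openConn a x), cls x ≠ cls y := by
  intro x hx hcx
  obtain ⟨hxA, hax⟩ := Finset.mem_filter.1 hx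
  have hax' : (openGraph ω).Reachable a x := hax
  exact hay (hax'.trans (hω x (Finset.mem_insert_of_mem hxA) y (Finset.mem_insert_of_mem hy) hcx))

/-- **Observer glued to a relay: the equality case.**  If `x ∈ A` and `μ{o ↮ x} = 0` then
`μ{1 ≤ N ≤ j} ≤ μ{|π(x)| ≤ j}`. [folklore] -/
theorem cil_of_glued (w : Sym2 (Fin n) → unitInterval) (A : Finset (Fin n)) (o x : Fin n) (j : ℕ)
    (h0 : (prodBernoulli w).real (openConn o x : Set (BondConfig (Fin n)))ᶜ = 0) :
    (prodBernoulli w).real {ω : BondConfig (Fin n) |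
        1 ≤ (A.filter fun y => ω ∈ openConn o y).card ∧
          (A.filter fun y => ω ∈ openConn o y).card ≤ j} ≤
      (prodBernoulli w).real {ω : BondConfig (Fin n) |
        (A.filter fun y => ω ∈ openConn x y).card ≤ j} := by
  set μ := prodBernoulli w with hμ
  set L := {ω : BondConfig (Fin n) | 1 ≤ (A.filter fun y => ω ∈ openConn o y).card ∧
    (A.filter fun y => ω ∈ openConn o y).card ≤ j} with hL
  set R := {ω : BondConfig (Fin n) | (A.filter fun y => ω ∈ openConn x y).card ≤ j} with hR
  have hsub : L ∩ (openConn o x : Set (BondConfig (Fin n))) ⊆ R := by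
    rintro ω ⟨⟨-, hle⟩, hox⟩
    have hox' : (openGraph ω).Reachable o x := hox
    show (A.filter fun y => ω ∈ openConn x y).card ≤ j
    rw [piCard_eq_of_reachable A o x ω hox']
    exact hle
  calc μ.real L ≤ μ.real (L ∩ openConn o x ∪ (openConn o x)ᶜ) := measureReal_mono fun ω hω => by
          by_cases h : ω ∈ (openConn o x : Set (BondConfig (Fin n)))
          · exact Or.inl ⟨hω, h⟩
          · exact Or.inr h
    _ ≤ μ.real (L ∩ openConn o x) + μ.real (openConn o x)ᶜ := measureReal_union_le _ _
    _ ≤ μ.real R + 0 := by rw [h0]; exact add_le_add_left (measureReal_mono hsub) _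
    _ = μ.real R := add_zero _


/-- On the good set, the relays joined to `o` contain every blob met: if `o ↔ a₀` then the block of
`a₀` is isolated from `A ∖ (block of a₀)` as soon as no other blob is joined to `o`. Bookkeeping form used
below: if `o ↔ a₀` and `b' , a` are relays with `cls b' = cls a₀`, `b' ↔ a`, then `o ↔ a`. [folklore] -/
theorem reach_of_block {b : ℕ} (A : Finset (Fin n)) (o : Fin n) (cls : Fin n → Fin b)
    (ω : BondConfig (Fin n))
    (hω : ∀ u ∈ insert o A, ∀ v ∈ insert o A, cls u = cls v → (openGraph ω).Reachable u v)
    {a₀ b' a : Fin n} (ha₀ : a₀ ∈ A) (hb' : b' ∈ A) (hoa₀ : (openGraph ω).Reachable o a₀)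
    (hcb' : cls b' = cls a₀) (hba : (openGraph ω).Reachable b' a) : (openGraph ω).Reachable o a :=
  (hoa₀.trans (hω a₀ (Finset.mem_insert_of_mem ha₀) b' (Finset.mem_insert_of_mem hb') hcb'.symm)).trans hba


end CILBlobs

open CILBlobs in
/-- **CIL for blob structures with no light pair (any number of blobs, every `|A|`, every level).**
If every two distinct nonempty relay blobs have joint mass `> j`, then some relay `a` has
`μ{1 ≤ N ≤ j} ≤ μ{|π(a)| ≤ j}`: on the good set the minority event forces `o` to hold exactly one light
blob `B_ℓ`, isolated from `A ∖ B_ℓ`; Kozma–Nitzan's Lemma 2 with the light blobs as (pairwise disjoint)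
blocks (`Theorems.blockLonelyRelay`) bounds the total by `max_ℓ μ{B_ℓ ↮ A ∖ B_ℓ}`, and
`{B_ℓ ↮ A ∖ B_ℓ} ⊆ {|π(a_ℓ)| ≤ j}` for any `a_ℓ ∈ B_ℓ`.
[cite: KozmaNitzan2024, Lemma 2 (p. 6); VandenbergHaggstromKahn2005, Thm. 1.3] -/
theorem cumulativeIsolation_blobs_noLightPair {b : ℕ} (w : Sym2 (Fin n) → unitInterval)
    (A : Finset (Fin n)) (o : Fin n) (j : ℕ) (cls : Fin n → Fin b)
    (hcls : ∀ u ∈ insert o A, ∀ v ∈ insert o A, cls u = cls v →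
      (prodBernoulli w).real (openConn u v)ᶜ = 0)
    (hheavy : ∀ ℓ ℓ' : Fin b, ℓ ≠ ℓ' → (A.filter fun a => cls a = ℓ).Nonempty →
      (A.filter fun a => cls a = ℓ').Nonempty →
      j < (A.filter fun a => cls a = ℓ).card + (A.filter fun a => cls a = ℓ').card)
    (hA : A.Nonempty) :
    ∃ a ∈ A, (prodBernoulli w).real {ω : BondConfig (Fin n) |
        1 ≤ (A.filter fun y => ω ∈ openConn o y).card ∧
          (A.filter fun y => ω ∈ openConn o y).card ≤ j} ≤
      (prodBernoulli w).real {ω : BondConfig (Fin n) |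
        (A.filter fun y => ω ∈ openConn a y).card ≤ j} := by
  set μ := prodBernoulli w with hμ
  set L := {ω : BondConfig (Fin n) | 1 ≤ (A.filter fun y => ω ∈ openConn o y).card ∧
    (A.filter fun y => ω ∈ openConn o y).card ≤ j} with hL
  set Bl : Fin b → Finset (Fin n) := fun ℓ => A.filter fun a => cls a = ℓ with hBl
  set Λ : Finset (Fin b) := Finset.univ.filter fun ℓ => (Bl ℓ).Nonempty ∧ (Bl ℓ).card ≤ j with hΛ
  set G := {ω : BondConfig (Fin n) | ∀ u ∈ insert o A, ∀ v ∈ insert o A,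
      cls u = cls v → (openGraph ω).Reachable u v} with hG
  set D : Finset (Fin n) → Set (BondConfig (Fin n)) :=
    fun B => {ω | ∀ b' ∈ B, ∀ a ∈ A \ B, ω ∉ openConn b' a} with hD
  set E : Finset (Fin n) → Set (BondConfig (Fin n)) :=
    fun B => {ω | ∃ b' ∈ B, ω ∈ openConn o b'} ∩ D B with hE
  -- the minority event, on the good set, lies in the union of the block events of the light blobs
  have hLsub : L ∩ G ⊆ ⋃ ℓ ∈ Λ, E (Bl ℓ) := by
    rintro ω ⟨⟨h1, hj⟩, hωG⟩
    obtain ⟨a₀, ha₀⟩ := Finset.card_pos.1 (by omega : 0 < (A.filter fun y => ω ∈ openConn o y).card)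
    obtain ⟨ha₀A, hoa₀⟩ := Finset.mem_filter.1 ha₀
    have hoa₀' : (openGraph ω).Reachable o a₀ := hoa₀
    have hcount := blobs_count_ge_one A o cls ω hωG ha₀A hoa₀'
    have ha₀B : a₀ ∈ Bl (cls a₀) := Finset.mem_filter.2 ⟨ha₀A, rfl⟩
    have hmem : cls a₀ ∈ Λ :=
      Finset.mem_filter.2 ⟨Finset.mem_univ _, ⟨a₀, ha₀B⟩, le_trans hcount hj⟩
    refine Set.mem_iUnion₂.2 ⟨cls a₀, hmem, ⟨a₀, ha₀B, hoa₀⟩, fun b' hb' a ha hba => ?_⟩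
    obtain ⟨hb'A, hcb'⟩ := Finset.mem_filter.1 hb'
    obtain ⟨haA, haB⟩ := Finset.mem_sdiff.1 ha
    have hca : cls a ≠ cls a₀ := fun h => haB (Finset.mem_filter.2 ⟨haA, h⟩)
    have hba' : (openGraph ω).Reachable b' a := hba
    have hoa : (openGraph ω).Reachable o a := reach_of_block A o cls ω hωG ha₀A hb'A hoa₀' hcb' hba'
    have htwo := blobs_count_ge_two A o cls ω hωG ha₀A haA hoa₀' hoa (Ne.symm hca)
    have hlt := hheavy (cls a₀) (cls a) (Ne.symm hca) ⟨a₀, ha₀B⟩ ⟨a, Finset.mem_filter.2 ⟨haA, rfl⟩⟩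
    omega
  by_cases hΛ : Λ.Nonempty
  · obtain ⟨ℓs, hℓs, hmax⟩ := Finset.exists_max_image Λ (fun ℓ => μ.real (D (Bl ℓ))) hΛ
    obtain ⟨hne, hcard⟩ := (Finset.mem_filter.1 hℓs).2
    obtain ⟨as, has⟩ := hne
    obtain ⟨hasA, hcas⟩ := Finset.mem_filter.1 has
    refine ⟨as, hasA, ?_⟩
    set t := μ.real (D (Bl ℓs)) with ht
    -- the isolation event of the heaviest-isolation light blob lies in `{|π(a)| ≤ j}`
    have hDR : t ≤ μ.real {ω : BondConfig (Fin n) | (A.filter fun y => ω ∈ openConn as y).card ≤ j} := by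
      refine measureReal_mono fun ω hω => ?_
      have hsubB : (A.filter fun y => ω ∈ openConn as y) ⊆ Bl ℓs := by
        intro y hy
        obtain ⟨hyA, hay⟩ := Finset.mem_filter.1 hy
        by_contra hyB
        exact hω as has y (Finset.mem_sdiff.2 ⟨hyA, hyB⟩) hay
      exact le_trans (Finset.card_le_card hsubB) hcard
    -- injectivity of `ℓ ↦ B_ℓ` on nonempty blobs, disjointness
    have hinj : ∀ ℓ ∈ Λ, ∀ ℓ' ∈ Λ, Bl ℓ = Bl ℓ' → ℓ = ℓ' := by
      intro ℓ hℓ ℓ' _ hBB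
      obtain ⟨⟨a, ha⟩, -⟩ := (Finset.mem_filter.1 hℓ).2
      have ha' : a ∈ Bl ℓ' := hBB ▸ ha
      exact (Finset.mem_filter.1 ha).2.symm.trans (Finset.mem_filter.1 ha').2
    have hsubA : ∀ B ∈ Λ.image Bl, B ⊆ A := by
      intro B hB
      obtain ⟨ℓ, -, rfl⟩ := Finset.mem_image.1 hB
      exact Finset.filter_subset _ _
    have hdisj : ∀ B' ∈ Λ.image Bl, ∀ B'' ∈ Λ.image Bl, B' ≠ B'' → Disjoint B' B'' := by
      intro B' hB' B'' hB'' hne'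
      obtain ⟨ℓ', -, rfl⟩ := Finset.mem_image.1 hB'
      obtain ⟨ℓ'', -, rfl⟩ := Finset.mem_image.1 hB''
      have hll : ℓ' ≠ ℓ'' := fun h => hne' (by rw [h])
      exact Finset.disjoint_filter.2 fun a _ h1 h2 => hll (h1.symm.trans h2)
    have hq : ∀ B ∈ Λ.image Bl, μ.real (D B) ≤ t := by
      intro B hB
      obtain ⟨ℓ, hℓ, rfl⟩ := Finset.mem_image.1 hB
      exact hmax ℓ hℓ
    have hLt : μ.real L ≤ t := by
      refine oneCut_of_blobs_trap w A o t cls hcls L (⋃ ℓ ∈ Λ, E (Bl ℓ)) hLsub ?_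
      calc μ.real (⋃ ℓ ∈ Λ, E (Bl ℓ)) ≤ ∑ ℓ ∈ Λ, μ.real (E (Bl ℓ)) :=
            measureReal_biUnion_finset_le _ _
        _ = ∑ B ∈ Λ.image Bl, μ.real (E B) := by rw [Finset.sum_image hinj]
        _ ≤ t := blockLonelyRelay w A o (Λ.image Bl) hsubA hdisj t measureReal_nonneg hq
    exact hLt.trans hDR
  · -- no light nonempty blob: the minority event is null
    obtain ⟨a, ha⟩ := hA
    refine ⟨a, ha, ?_⟩
    have hΛe : Λ = ∅ := Finset.not_nonempty_iff_eq_empty.1 hΛ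
    have h0 : μ.real L ≤ 0 := by
      refine oneCut_of_blobs_trap w A o 0 cls hcls L ∅ (fun ω hω => ?_) (by simp)
      have := hLsub hω
      rw [hΛe] at this
      simp at this
    exact h0.trans measureReal_nonneg


end Summit.CriticalPhenomena.PercolationContinuityZ3.Theorems

end
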